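import Literature.MathematicalPhysics.KineticTheory.IllnerPulvirentiFactorisation
import Literature.MathematicalPhysics.KineticTheory.IllnerPulvirentiCollisionDispersiveBBGKY
import Literature.MathematicalPhysics.KineticTheory.IllnerPulvirentiTransportDispersive
import Literature.Analysis.FluidPDE.BBGKYMarginalsProofs
import HarnessLib

/-!
# Global bounds for the Duhamel chains of the BBGKY hierarchy of hard spheres on `ℝ^d` (CIP 1994 Thm 4.5.1, Step 3)

Topic: MathematicalPhysics / KineticTheory. A brick of the BBGKY side of the convergence half of
the named fact `Literature.MathematicalPhysics.KineticTheory.illner_pulvirenti`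
(Cercignani–Illner–Pulvirenti 1994 Thm 4.5.1; Illner–Pulvirenti 1986/1989): the interacting
twin of `IllnerPulvirentiBoltzmannSeriesBounds`. Step 3 of the proof of CIP Thm 4.5.1 (pp. 88–90)
bounds the `n`-th term of the series solution `P_σ` of the BBGKY hierarchy of the rare cloud,
GLOBALLY in time, by `bˢ cⁿ (bα)ⁿ ((s+n)ⁿ/n!) S₀(t) e^{-β₀ I}` ((5.9)); this file proves that
bound for every Duhamel chain of the hard-sphere BBGKY hierarchy on `ℝ^d` built with the
good-set transports `1_{good} · (g ∘ Φ_{-t})` of hard-sphere flows (`gcEvolved` convention) and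
the tree's `bbgkyOp` (prefactor `(N - s) ε^{d-1}`): `abs_bbgkyChain_le_global`. The three inputs
are the abstract chain estimate of `IllnerPulvirentiChainEstimate`, the dispersion inequalities of
`HardSphereDispersion` through `IllnerPulvirentiTransportDispersive` (CIP (5.3), Lemma
4.2.3–4.2.4), and the single-step estimate of `IllnerPulvirentiCollisionDispersiveBBGKY`
(CIP (5.2)–(5.7)).

Theorems only. Not here: the identification of the correlation functions of `gcEvolved`
grand-canonical data with such a Duhamel series (the rigorous BBGKY hierarchy in `ℝ^d`,
CIP App. 4.B), and the term-by-term convergence (CIP §4.4 Step 1).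

## References

* C. Cercignani, R. Illner, M. Pulvirenti, *The Mathematical Theory of Dilute Gases*, Applied
  Mathematical Sciences 106, Springer (1994), §4.5, proof of Thm 4.5.1, Step 3, (5.1)–(5.9),
  pp. 88–90.
* R. Illner, M. Pulvirenti, Comm. Math. Phys. 105 (1986) 189–203; 121 (1989) 143–146.
-/

open MeasureTheory Metric Real Set Filter Topology
open scoped InnerProductSpace ENNReal Nat
open Literature.Analysis.FluidPDE

namespace Literature.MathematicalPhysics.KineticTheory

noncomputable section

variable {d : Type*} [Fintype d]

/-- **Global-in-time bound on the Duhamel chains of the BBGKY hierarchy of hard spheres on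
`ℝ^d`, good-set transports** (CIP 1994 Thm 4.5.1, Step 3, (5.1)–(5.9): "an upper bound for the
`n`th term in the series expansion … `P_σ^{(s)}(z^s, t) ≤ b^s ∑_n cⁿ (bα)ⁿ ((s+n)ⁿ/n!) S₀(t) exp(-β₀ I(z^s))`").
For hard-sphere flows `Φ s` on `ℝ^d` (diameter `ε ≥ 0`, `N` particles in the prefactor of
`C_{s,s+1}`), any family `R n s t` obeying the Duhamel recursion with the good-set transports
`1_{good} · hsTransport (Φ s)` (as in `gcEvolved`) and the BBGKY operator `bbgkyOp G ε N`, if the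
innermost slot satisfies `|R 0 (s+n) τ (Z)| ≤ K e^{-β₀ I_τ(Z)} e^{-λ H(Z)}` on `[0, T]`, then for
`t ∈ [0, T]`, `n ≥ 1`, `d ≥ 2`,
`|R n s t (Z_s)| ≤ e^{s-1} (e² 2^{(d+3)/2} λ^{-(d+1)/2} · N ε^{d-1} · C∞)ⁿ K e^{-β₀ I_t(Z_s)} e^{-(λ/2) H(Z_s)}`,
uniformly in `t` and `T` — in the Boltzmann–Grad scaling `N ε^{d-1} ≤ α` this is CIP (5.9) with
`(bα)ⁿ`. Ingredients: the abstract chain estimate `abs_duhamelChain_le_dispersive_of_le`, the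
dispersive transport `HardSphereFlow.abs_indicator_hsTransport_le_dispersive` (Lemma 4.2.4) and
the single-step estimate `abs_bbgkyOp_le_dispersive`. [cite: CIP1994, §4.5 (5.1)–(5.9)] -/
theorem abs_bbgkyChain_le_global (hd : 2 ≤ Fintype.card d) {ε : ℝ} (hε : 0 ≤ ε) (N : ℕ)
    (Φ : (s : ℕ) → HardSphereFlow (Euclidean.geometry d) ε s) {β₀ lam K : ℝ}
    (hβ₀ : 0 < β₀) (hlam : 0 < lam) (hK : 0 ≤ K)
    (R : ℕ → (s : ℕ) → ℝ → Config s d (EuclideanSpace ℝ d) → ℝ)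
    (hR : ∀ (n s : ℕ) (t : ℝ) (Z : Config s d (EuclideanSpace ℝ d)),
      R (n + 1) s t Z = ∫ τ in (0 : ℝ)..t,
        (Φ s).good.indicator (hsTransport (Φ s) (t - τ)
          (bbgkyOp (Euclidean.geometry d) ε N s (R n (s + 1) τ))) Z)
    {T : ℝ} (hT : 0 ≤ T) (s n : ℕ) (hn : 1 ≤ n)
    (h0 : ∀ τ ∈ Icc 0 T, ∀ Z : Config (s + n) d (EuclideanSpace ℝ d), |R 0 (s + n) τ Z| ≤
      K * (exp (-β₀ * ∑ j, ‖(Z j).1 - τ • (Z j).2‖ ^ 2) * exp (-lam * configEnergy Z)))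
    {t : ℝ} (ht : t ∈ Icc 0 T) (Z : Config s d (EuclideanSpace ℝ d)) :
    |R n s t Z| ≤
      exp (s - 1) *
        (exp 2 * (sqrt 2 ^ (Fintype.card d + 3) / sqrt lam ^ (Fintype.card d + 1)) *
          ((N * ε ^ (Fintype.card d - 1)) *
          ((KineticTheory.sphereMeasure : Measure (sphere (0 : EuclideanSpace ℝ d) 1)).real univ *
            (2 ^ Fintype.card d *
              (2 ^ Fintype.card d * (∫ w : EuclideanSpace ℝ d, exp (-‖w‖ ^ 2)) +
                sqrt lam ^ Fintype.card d * ∫ w : EuclideanSpace ℝ d, exp (-β₀ * ‖w‖ ^ 2)))))) ^ n *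
        K * (exp (-β₀ * ∑ j, ‖(Z j).1 - t • (Z j).2‖ ^ 2) * exp (-(lam / 2) * configEnergy Z)) := by
  set D : ℕ := Fintype.card d with hD
  set S₀ : ℝ := (KineticTheory.sphereMeasure : Measure (sphere (0 : EuclideanSpace ℝ d) 1)).real univ
    with hS₀
  set S : ℝ := (N * ε ^ (D - 1)) * S₀ with hS
  have hS₀0 : 0 ≤ S₀ := measureReal_nonneg
  set Cβ : ℝ := 2 ^ D * (2 ^ D * (∫ w : EuclideanSpace ℝ d, exp (-‖w‖ ^ 2)) +
      sqrt lam ^ D * ∫ w : EuclideanSpace ℝ d, exp (-β₀ * ‖w‖ ^ 2)) with hCβ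
  have hS0 : 0 ≤ S := by positivity
  have hCβ0 : 0 ≤ Cβ := by
    have h1 : 0 ≤ ∫ w : EuclideanSpace ℝ d, exp (-‖w‖ ^ 2) := integral_nonneg fun w => (exp_pos _).le
    have h2 : 0 ≤ ∫ w : EuclideanSpace ℝ d, exp (-β₀ * ‖w‖ ^ 2) :=
      integral_nonneg fun w => (exp_pos _).le
    positivity
  -- the dispersive factor, the cost and the weights
  set Dsp : ℝ → (m : ℕ) → Config m d (EuclideanSpace ℝ d) → ℝ := fun τ m Z' =>
    exp (-β₀ * ∑ j, ‖(Z' j).1 - τ • (Z' j).2‖ ^ 2) with hDsp_def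
  have hDsp : ∀ τ m Z', 0 ≤ Dsp τ m Z' := fun τ m Z' => (exp_pos _).le
  set A : ℝ → ℝ := fun τ => S * Cβ * ((1 + |τ|) ^ D)⁻¹ with hA_def
  have hApos : ∀ τ : ℝ, 0 < (1 + |τ|) ^ D := fun τ => by positivity
  have hAc : Continuous A := by
    simp only [hA_def]
    exact continuous_const.mul (Continuous.inv₀ (by fun_prop) fun τ => (hApos τ).ne')
  have hA0 : ∀ τ, 0 ≤ A τ := fun τ => by
    simp only [hA_def]
    exact mul_nonneg (mul_nonneg hS0 hCβ0) (inv_nonneg.2 (hApos τ).le)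
  -- the parameters of the chain
  have hbm : 0 < lam / 2 := half_pos hlam
  have hn0 : (0 : ℝ) < n := by exact_mod_cast hn
  have hδ : 0 < lam / (2 * n) := by positivity
  have hkmax : s + n ≤ (s + n - 1) + 1 := by omega
  have hsum : lam / 2 + n * (lam / (2 * n)) = lam := by field_simp; ring
  have hbmax : lam / 2 + n * (lam / (2 * n)) ≤ lam := hsum.le
  -- the hypotheses of the abstract chain estimate
  have htr : ∀ (m : ℕ) (b τ t' : ℝ), 0 ≤ τ → τ ≤ t' →
      ∀ (g : Config m d (EuclideanSpace ℝ d) → ℝ) (K' : ℝ), 0 ≤ K' →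
      (∀ Z', |g Z'| ≤ K' * (Dsp τ m Z' * exp (-b * configEnergy Z'))) →
      ∀ Z', |(Φ m).good.indicator (hsTransport (Φ m) (t' - τ) g) Z'| ≤
        K' * (Dsp t' m Z' * exp (-b * configEnergy Z')) :=
    fun m b τ t' hτ hτt g K' hK' hg Z' =>
      (Φ m).abs_indicator_hsTransport_le_dispersive hβ₀.le hτ hτt hK' hg Z'
  have hop : ∀ (k : ℕ) (g : Config (k + 1) d (EuclideanSpace ℝ d) → ℝ) (K' b τ : ℝ),
      0 < b → b ≤ lam → 0 ≤ K' → 0 ≤ τ →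
      (∀ Z', |g Z'| ≤ K' * (Dsp τ (k + 1) Z' * exp (-b * configEnergy Z'))) →
      ∀ Z' : Config k d (EuclideanSpace ℝ d), |bbgkyOp (Euclidean.geometry d) ε N k g Z'| ≤
        A τ * (sqrt b ^ Fintype.card d)⁻¹ * (k * (sqrt b)⁻¹ + ∑ i, ‖(Z' i).2‖) *
          (K' * (Dsp τ k Z' * exp (-b * configEnergy Z'))) := by
    intro k g K' b τ hb hble hK' hτ hg Z'
    have h := abs_bbgkyOp_le_dispersive hε N k hb hble hβ₀ hτ hK' hg Z'
    have hAτ : A τ = (N * ε ^ (D - 1)) * (S₀ * (Cβ / (1 + τ) ^ D)) := by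
      simp only [hA_def, hS, abs_of_nonneg hτ]
      ring
    rw [hAτ]
    simpa only [hS₀, hCβ, hD, mul_assoc] using h
  -- the innermost slot
  have h0' : ∀ τ ∈ Icc 0 T, ∀ Z' : Config (s + n) d (EuclideanSpace ℝ d), |R 0 (s + n) τ Z'| ≤
      K * (Dsp τ (s + n) Z' * exp (-(lam / 2 + n * (lam / (2 * n))) * configEnergy Z')) := by
    intro τ hτ Z'
    rw [hsum]
    exact h0 τ hτ Z'
  -- the abstract chain estimate
  have hchain := abs_duhamelChain_le_dispersive_of_le (X := EuclideanSpace ℝ d)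
    (transport := fun m t' g => (Φ m).good.indicator (hsTransport (Φ m) t' g))
    (op := fun m => bbgkyOp (Euclidean.geometry d) ε N m)
    hDsp htr hAc hA0 hop R hR hT hbm hδ (s + n - 1) n s (s + n) rfl hkmax le_rfl hbmax hK h0' t ht Z
  refine hchain.trans ?_
  -- the time integral of the cost is at most `S Cβ`
  have hM : ∫ σ in (0 : ℝ)..t, A σ ≤ S * Cβ := by
    simp only [hA_def]
    rw [intervalIntegral.integral_const_mul]
    calc S * Cβ * ∫ σ in (0 : ℝ)..t, ((1 + |σ|) ^ D)⁻¹ ≤ S * Cβ * 1 :=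
          mul_le_mul_of_nonneg_left (intervalIntegral_inv_one_add_abs_pow_le_one hd ht.1)
            (mul_nonneg hS0 hCβ0)
      _ = S * Cβ := mul_one _
  have hM0 : 0 ≤ ∫ σ in (0 : ℝ)..t, A σ := intervalIntegral.integral_nonneg ht.1 fun σ _ => hA0 σ
  -- the BGSR constants
  have hΛ := chainConst_le (A := 1) zero_le_one hlam s n D
  rw [one_mul, one_mul] at hΛ
  set Λ : ℝ := (sqrt (lam / 2) ^ D)⁻¹ *
    ((s + n - 1 : ℕ) * (sqrt (lam / 2))⁻¹ + sqrt ((s + n - 1 : ℕ) / (lam / (2 * n)))) with hΛdef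
  set Λ' : ℝ := sqrt 2 ^ (D + 3) / sqrt lam ^ (D + 1) with hΛ'
  have hΛ0 : 0 ≤ Λ := by positivity
  have hΛ'0 : 0 ≤ Λ' := by positivity
  have hW0 : 0 ≤ Dsp t s Z * exp (-(lam / 2) * configEnergy Z) := by positivity
  -- `Λⁿ Mⁿ / n! ≤ (Λ' (s+n))ⁿ (S Cβ)ⁿ / n! ≤ e^{s-1} (e² Λ' S Cβ)ⁿ`
  have hstep1 : Λ ^ n * (∫ σ in (0 : ℝ)..t, A σ) ^ n / n ! ≤
      (Λ' * (s + n : ℕ)) ^ n * (S * Cβ) ^ n / n ! := by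
    have h1 : Λ ^ n ≤ (Λ' * (s + n : ℕ)) ^ n := pow_le_pow_left₀ hΛ0 hΛ n
    have h2 : (∫ σ in (0 : ℝ)..t, A σ) ^ n ≤ (S * Cβ) ^ n := pow_le_pow_left₀ hM0 hM n
    have h3 : 0 ≤ (Λ' * (s + n : ℕ)) ^ n := by positivity
    rw [div_le_div_iff_of_pos_right (by positivity : (0 : ℝ) < n !)]
    exact mul_le_mul h1 h2 (by positivity) h3
  have hstep2 := pow_chainConst_mul_le hΛ'0 (mul_nonneg hS0 hCβ0) s n hn
  calc K * Λ ^ n * (∫ σ in (0 : ℝ)..t, A σ) ^ n / n ! *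
        (Dsp t s Z * exp (-(lam / 2) * configEnergy Z))
      = (Λ ^ n * (∫ σ in (0 : ℝ)..t, A σ) ^ n / n !) *
          (K * (Dsp t s Z * exp (-(lam / 2) * configEnergy Z))) := by ring
    _ ≤ ((Λ' * (s + n : ℕ)) ^ n * (S * Cβ) ^ n / n !) *
          (K * (Dsp t s Z * exp (-(lam / 2) * configEnergy Z))) :=
        mul_le_mul_of_nonneg_right hstep1 (mul_nonneg hK hW0)
    _ ≤ (exp (s - 1) * (exp 2 * Λ' * (S * Cβ)) ^ n) *
          (K * (Dsp t s Z * exp (-(lam / 2) * configEnergy Z))) :=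
        mul_le_mul_of_nonneg_right hstep2 (mul_nonneg hK hW0)
    _ = _ := by
        simp only [hΛ', hDsp_def, hS]
        ring


/-! ## The Duhamel terms of grand-canonical rare-cloud data -/

/-- **Global bound on the Duhamel terms of the BBGKY hierarchy with good-set transports**
(CIP 1994 (5.9)): if the initial family satisfies `|F₀^{(s+n)}(Z)| ≤ K e^{-β₀ ∑_j |x_j|²} e^{-λ H(Z)}`
then for every `t ≥ 0` and `Z_s`, `n ≥ 1`, `d ≥ 2`,
`|Q^ε_{s,s+n}(t) F₀ (Z_s)| ≤ e^{s-1} (e² 2^{(d+3)/2} λ^{-(d+1)/2} N ε^{d-1} C∞)ⁿ K e^{-β₀ I_t(Z_s)} e^{-(λ/2) H(Z_s)}`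
for the Duhamel terms built with `1_{good} · hsTransport (Φ s)` and `bbgkyOp G ε N`.
[cite: CIP1994, §4.5 (5.9)] -/
theorem abs_bbgkyDuhamelTerm_indicator_le_global (hd : 2 ≤ Fintype.card d) {ε : ℝ} (hε : 0 ≤ ε)
    (N : ℕ) (Φ : (s : ℕ) → HardSphereFlow (Euclidean.geometry d) ε s) {β₀ lam K : ℝ}
    (hβ₀ : 0 < β₀) (hlam : 0 < lam) (hK : 0 ≤ K)
    (F₀ : GCState d (EuclideanSpace ℝ d)) (s n : ℕ) (hn : 1 ≤ n)
    (hF : ∀ Z : Config (s + n) d (EuclideanSpace ℝ d), |F₀ (s + n) Z| ≤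
      K * (exp (-β₀ * ∑ j, ‖(Z j).1‖ ^ 2) * exp (-lam * configEnergy Z)))
    {t : ℝ} (ht : 0 ≤ t) (Z : Config s d (EuclideanSpace ℝ d)) :
    |duhamelTerm (fun m t' g => (Φ m).good.indicator (hsTransport (Φ m) t' g))
        (fun m => bbgkyOp (Euclidean.geometry d) ε N m) n s t F₀ Z| ≤
      exp (s - 1) *
        (exp 2 * (sqrt 2 ^ (Fintype.card d + 3) / sqrt lam ^ (Fintype.card d + 1)) *
          ((N * ε ^ (Fintype.card d - 1)) *
          ((KineticTheory.sphereMeasure : Measure (sphere (0 : EuclideanSpace ℝ d) 1)).real univ *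
            (2 ^ Fintype.card d *
              (2 ^ Fintype.card d * (∫ w : EuclideanSpace ℝ d, exp (-‖w‖ ^ 2)) +
                sqrt lam ^ Fintype.card d * ∫ w : EuclideanSpace ℝ d, exp (-β₀ * ‖w‖ ^ 2)))))) ^ n *
        K * (exp (-β₀ * ∑ j, ‖(Z j).1 - t • (Z j).2‖ ^ 2) * exp (-(lam / 2) * configEnergy Z)) := by
  refine abs_bbgkyChain_le_global hd hε N Φ hβ₀ hlam hK
    (fun n s t => duhamelTerm (fun m t' g => (Φ m).good.indicator (hsTransport (Φ m) t' g))
      (fun m => bbgkyOp (Euclidean.geometry d) ε N m) n s t F₀)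
    (fun n s t Z => duhamelTerm_succ _ _ n s t F₀ Z) ht s n hn (fun τ hτ Z' => ?_) ⟨ht, le_rfl⟩ Z
  rw [duhamelTerm_zero]
  have hF' : ∀ Z'' : Config (s + n) d (EuclideanSpace ℝ d), |F₀ (s + n) Z''| ≤
      K * (exp (-β₀ * ∑ j, ‖(Z'' j).1 - (0 : ℝ) • (Z'' j).2‖ ^ 2) *
        exp (-lam * configEnergy Z'')) := fun Z'' => by
    simpa only [zero_smul, sub_zero] using hF Z''
  have h := (Φ (s + n)).abs_indicator_hsTransport_le_dispersive hβ₀.le le_rfl hτ.1 hK hF' Z'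
  rwa [sub_zero] at h

/-- A function on `ℝ^d × ℝ^d` dominated by the Gaussian `c e^{-(β₀/2)(|x|² + |v|²)}`, `β₀ > 0`,
and continuous is integrable. [folklore] -/
theorem integrable_of_abs_le_gaussian {β₀ c : ℝ} (hβ₀ : 0 < β₀)
    {f₀ : EuclideanSpace ℝ d × EuclideanSpace ℝ d → ℝ} (hf₀c : Continuous f₀)
    (hf₀b : ∀ z, |f₀ z| ≤ c * exp (-(β₀ / 2) * (‖z.1‖ ^ 2 + ‖z.2‖ ^ 2))) :
    Integrable f₀ := by
  have hg := (Literature.Analysis.FluidPDE.integrable_exp_neg_mul_sq_norm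
    (E := EuclideanSpace ℝ d) (half_pos hβ₀)).mul_prod
    (Literature.Analysis.FluidPDE.integrable_exp_neg_mul_sq_norm (E := EuclideanSpace ℝ d) (half_pos hβ₀))
  refine (hg.const_mul c).mono' hf₀c.aestronglyMeasurable (Eventually.of_forall fun z => ?_)
  rw [Real.norm_eq_abs]
  refine (hf₀b z).trans (le_of_eq ?_)
  rw [mul_add, exp_add]

/-- **The grand-canonical rare-cloud data meet the hypothesis of the global BBGKY bounds**
(CIP 1994 Thm 4.5.1 hypothesis ii), `sup P^{(s)}(z, 0) e^{β₀ ∑(x_i² + ξ_i²)} ≤ c bˢ`): for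
`0 ≤ f₀ ≤ c e^{-(β₀/2)(|x|² + |v|²)}` continuous, `ε, μ ≥ 0`, the rescaled correlation functions of
`gcInitial (Euclidean.geometry d) ε μ f₀` satisfy
`|F^{(m)}(Z)| ≤ c^m e^{-(β₀/2) ∑_j |x_j|²} e^{-β₀ H(Z)}` (`correlationFn_gcInitial_le_holds`,
`correlationFn_gcInitial_nonneg_holds`, `abs_tensorPow_le_dispersive` at `t = 0`).
[cite: CIP1994, §4.5 Thm 4.5.1 (hypothesis ii)] -/
theorem abs_correlationFn_gcInitial_le_dispersive {ε μ β₀ c : ℝ} (hμ : 0 ≤ μ) (hβ₀ : 0 < β₀)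
    {f₀ : EuclideanSpace ℝ d × EuclideanSpace ℝ d → ℝ} (hf₀c : Continuous f₀)
    (hf₀nn : ∀ z, 0 ≤ f₀ z)
    (hf₀b : ∀ x v, f₀ (x, v) ≤ c * exp (-(β₀ / 2) * (‖x‖ ^ 2 + ‖v‖ ^ 2)))
    (m : ℕ) (Z : Config m d (EuclideanSpace ℝ d)) :
    |correlationFn μ (gcInitial (Euclidean.geometry d) ε μ f₀) m Z| ≤
      c ^ m * (exp (-(β₀ / 2) * ∑ j, ‖(Z j).1‖ ^ 2) * exp (-β₀ * configEnergy Z)) := by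
  have hf₀b' : ∀ z, |f₀ z| ≤ c * exp (-(β₀ / 2) * (‖z.1‖ ^ 2 + ‖z.2‖ ^ 2)) := fun z => by
    rw [abs_of_nonneg (hf₀nn z)]
    exact hf₀b z.1 z.2
  have hint : Integrable f₀ := integrable_of_abs_le_gaussian hβ₀ hf₀c hf₀b'
  have h0 := correlationFn_gcInitial_nonneg_holds (Euclidean.geometry d) ε hμ (fun z => hf₀nn z) hint m Z
  have h1 := correlationFn_gcInitial_le_holds (Euclidean.measurable_geometry_sepVec (d := d)) ε hμ
    (fun z => hf₀nn z) hint m Z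
  rw [abs_of_nonneg h0]
  refine h1.trans ?_
  have hT0 : 0 ≤ tensorPow m f₀ Z := tensorPow_nonneg (fun z => hf₀nn z) m Z
  refine (indicator_le_self' (fun _ _ => hT0) Z).trans ?_
  have h2 := abs_tensorPow_le_dispersive (t := 0) (F := f₀) (fun x v => by
    rw [zero_smul, sub_zero]; exact hf₀b' (x, v)) Z
  rw [abs_of_nonneg hT0] at h2
  simpa only [zero_smul, sub_zero] using h2

end

end Literature.MathematicalPhysics.KineticTheory
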